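import Mathlib
import Literature.Analysis.FluidPDE.Tao2016AveragedNS.BoundedEternalSolutions
import Literature.Analysis.FluidPDE.Tao2016AveragedNS.CascadeTableDictionary
import Summits.NavierStokesRegularity.NavierStokesRegularity.Theorems.TaoLadderRungTwoBreakDSSWaveOfQuadTermDatum
import Summits.NavierStokesRegularity.NavierStokesRegularity.Theorems.WakeRatchetAdmissibleEternalBoundCritical
import HarnessLib

/-!
# The self-similar RENORMALISATION of an exact cascade flow around a time `T`:
  `W_n(σ) = Λ^n e^{-σ} X_n(T - e^{-σ})` solves the INVISCID ETERNAL LAW (`IsEternal.law`) on the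
  half-line `e^{-σ} < T`, and the dictionary «type I ⟺ uniform bound», «(S₁)-survival of the blow-up ⟺
  forward survival of `W`» — support for the extraction stub `stub_eternalFromBlowup` of K2(1)
  `TaoLadderRungTwoBreak.BlowupRigidityOne` (stmt-NavierStokesRegularity-20206)

MODEL lattice ODEs only (Tao 2016 §4 (4.12) and §6.4, renormalising the dynamics); nothing here is a
statement about the Navier–Stokes equations; NO item is closed (`--supports
stmt-NavierStokesRegularity-20206`). Route-independent module; general `m`. The renormalised family is
not introduced as a definition: it is any `W : ℤ → ℝ → Em m` with
`W n σ = (Λ^n e^{-σ}) • shellVec X n (T - e^{-σ})` (hypothesis `hW`; for `m = 4` this is the WakeRatchet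
kit's `ClockedFrames.renorm ε₀ T X`).

Applied to the maximal exact flow of a robustly blowing-up table
(`BlowupRigidityOne.maximalExactFlow_of_noGlobalCascade`, `T = T⋆`), this file turns the extraction stub
(`∃ W, IsEternal ε₀ α W ∧ EternalSurvivingFwd 1 ε₀ W`) into three named physical-time obligations:

* `renormalisedFlow_law` — DONE HERE: the eternal law of `IsEternal` (damping `1`, feed `Λ`, drain
  `Λ⁻¹`, `ν̂ = 0`) holds for `W` at every `σ` with `e^{-σ} < T`, i.e. on the half-line
  `σ > -log T` (chain rule through `t = T - e^{-σ}` and the degree-two homogeneity of `tableQ`,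
  `tableA`, `tableB`); what is missing for `IsEternal.law` is the extension to ALL `σ ∈ ℝ` — an
  ω-limit of the translates `W_{·+m}(· + s)`, which needs compactness, i.e.
* `renormalisedFlow_norm` / `uniformBound_iff_typeI` — TYPE I: `‖W_n(σ)‖ = Λ^n (T-t)‖X_n(t)‖`, so a
  uniform bound of `W` on the half-line is literally the type-I clause `Λ^n(T-t)‖X_n(t)‖ ≤ C` (open,
  N-39);
* `renormalisedFlow_weightedEnergy` / `eternalSurvivingFwd_of_physicalSurvival` — SURVIVAL: the
  `a = 1`-weighted renormalised energy is `physWeight^n e^{2σ}‖W_n(σ)‖² = (1+ε₀)^n‖X_n(t)‖²`, so `W` is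
  forward (S₁)-surviving as soon as the blow-up keeps `(1+ε₀)^n‖X_n(t)‖² ≥ c` at arbitrarily high shells
  arbitrarily close to `T` (the «lower pinning» of the WakeRatchet cruxes; open).
-/

noncomputable section

-- the summit and its single sub-problem share the name (CONVENTIONS §1)
set_option linter.dupNamespace false

open Set Filter Topology

namespace Summit.NavierStokesRegularity.NavierStokesRegularity.Theorems

namespace BlowupRigidityOne

open Literature.Analysis.FluidPDE Literature.Analysis.FluidPDE.TaoCascade
open DSSOneShift (hasDerivWithinAt_shellVec shellVec_quadTerm_normalForm)
open WakeRatchetCritical (tableQ_smul tableA_smul tableB_smul_smul)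

variable {m : ℕ}

/-! ### Interior derivatives of an exact flow -/

/-- On `(0,T)` the one-sided exact law `derivWithin (X i k) [0,∞) t = quadTerm_{i,k}(X)(t)` of a flow that
is `C¹` on `[0,T)` is a two-sided derivative. [cite: Tao2016AveragedNS, §4 (4.12)] -/
theorem hasDerivAt_of_exactFlow {ε₀ T : ℝ} {α : Fin m → Fin m → Fin m → ℤ × ℤ × ℤ → ℝ}
    {X : Fin m → ℤ → ℝ → ℝ} (hC1 : ∀ i n, ContDiffOn ℝ 1 (X i n) (Set.Ico 0 T))
    (hmot : ∀ i n t, 0 ≤ t → t < T → derivWithin (X i n) (Set.Ici 0) t = quadTerm ε₀ α X i n t)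
    (i : Fin m) (k : ℤ) {t : ℝ} (ht : t ∈ Ioo 0 T) :
    HasDerivAt (X i k) (quadTerm ε₀ α X i k t) t := by
  have hIco : Ico 0 T ∈ 𝓝 t := mem_of_superset (isOpen_Ioo.mem_nhds ht) Ioo_subset_Ico_self
  have hd : DifferentiableAt ℝ (X i k) t :=
    ((hC1 i k).differentiableOn one_ne_zero t (Ioo_subset_Ico_self ht)).differentiableAt hIco
  have h1 := hd.hasDerivAt
  have h2 : deriv (X i k) t = derivWithin (X i k) (Ici 0) t :=
    (derivWithin_of_mem_nhds (Ici_mem_nhds ht.1)).symm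
  rw [h2, hmot i k t ht.1.le ht.2] at h1
  exact h1

/-- The shell vector of an exact flow is differentiable on `(0,T)` with derivative the shell vector of
the nonlinearity, in NORMAL FORM `Λ^k • (Q(x_k) + Λ⁻¹ • A(x_{k-1}) + B(x_{k+1}, x_k))`.
[cite: Tao2016AveragedNS, §4 (4.8), (4.12)] -/
theorem hasDerivAt_shellVec_of_exactFlow {ε₀ T : ℝ} (hε : 0 < ε₀)
    {α : Fin m → Fin m → Fin m → ℤ × ℤ × ℤ → ℝ}
    {X : Fin m → ℤ → ℝ → ℝ} (hC1 : ∀ i n, ContDiffOn ℝ 1 (X i n) (Set.Ico 0 T))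
    (hmot : ∀ i n t, 0 ≤ t → t < T → derivWithin (X i n) (Set.Ici 0) t = quadTerm ε₀ α X i n t)
    (k : ℤ) {t : ℝ} (ht : t ∈ Ioo 0 T) :
    HasDerivAt (shellVec X k)
      (bigLam ε₀ ^ k • (tableQ α (shellVec X k t) + (bigLam ε₀)⁻¹ • tableA α (shellVec X (k - 1) t)
        + tableB α (shellVec X (k + 1) t) (shellVec X k t))) t := by
  have hv : HasDerivWithinAt (shellVec X k)
      (WithLp.toLp 2 fun i => quadTerm ε₀ α X i k t) univ t :=
    hasDerivWithinAt_shellVec fun i => (hasDerivAt_of_exactFlow hC1 hmot i k ht).hasDerivWithinAt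
  have heq : (WithLp.toLp 2 fun i => quadTerm ε₀ α X i k t : Em m) =
      shellVec (fun i n s => quadTerm ε₀ α X i n s) k t := rfl
  rw [heq, shellVec_quadTerm_normalForm (by linarith) α X k t] at hv
  exact hasDerivWithinAt_univ.1 hv

/-! ### The renormalised flow solves the eternal law on the half-line `e^{-σ} < T` -/

/-- **THE RENORMALISED FLOW SOLVES THE INVISCID ETERNAL LAW ON A HALF-LINE.** Let `X` be an exact flow on
`[0,T)` (`C¹` on `[0,T)`, `derivWithin (X i n) [0,∞) t = quadTerm_{i,n}(X)(t)` for `0 ≤ t < T`), `ε₀ > 0`,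
and `W_n(σ) = (Λ^n e^{-σ}) • x_n(T - e^{-σ})` its self-similar renormalisation around `T`
(`Λ = bigLam ε₀`). Then at every log-time `σ` with `e^{-σ} < T` (so `t = T - e^{-σ} ∈ (0,T)`) the shell
`n` of `W` satisfies EXACTLY the law of an admissible inviscid eternal solution (`IsEternal.law`):
`W_n' = -W_n + Q(W_n) + Λ A(W_{n-1}) + Λ⁻¹ B(W_{n+1}, W_n)` — chain rule through `t = T - e^{-σ}`
(`dt/dσ = e^{-σ}`) and the degree-two homogeneity of `tableQ`, `tableA`, `tableB`.
[cite: Tao2016AveragedNS, §6.4 (renormalising the dynamics: `s = -log(t⋆ - t)`) with §4 (4.8), (4.12); cell vocabulary (`IsEternal`)] -/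
theorem renormalisedFlow_law {ε₀ T : ℝ} (hε : 0 < ε₀)
    {α : Fin m → Fin m → Fin m → ℤ × ℤ × ℤ → ℝ}
    {X : Fin m → ℤ → ℝ → ℝ} (hC1 : ∀ i n, ContDiffOn ℝ 1 (X i n) (Set.Ico 0 T))
    (hmot : ∀ i n t, 0 ≤ t → t < T → derivWithin (X i n) (Set.Ici 0) t = quadTerm ε₀ α X i n t)
    {W : ℤ → ℝ → Em m}
    (hW : ∀ n σ, W n σ = (bigLam ε₀ ^ n * Real.exp (-σ)) • shellVec X n (T - Real.exp (-σ)))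
    (n : ℤ) {σ : ℝ} (hσ : Real.exp (-σ) < T) :
    HasDerivAt (W n)
      (-((1 : ℝ) • W n σ) + tableQ α (W n σ) + bigLam ε₀ • tableA α (W (n - 1) σ)
        + (bigLam ε₀)⁻¹ • tableB α (W (n + 1) σ) (W n σ)) σ := by
  have hL : 0 < bigLam ε₀ := bigLam_pos (by linarith)
  have hLne : bigLam ε₀ ≠ 0 := hL.ne'
  set E : ℝ := Real.exp (-σ) with hEdef
  have hE : 0 < E := Real.exp_pos _
  have ht : T - E ∈ Ioo 0 T := ⟨by linarith, by linarith⟩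
  -- the pieces of the chain rule
  have hexp : HasDerivAt (fun v => Real.exp (-v)) (-E) σ := by
    have h := (Real.hasDerivAt_exp (-σ)).comp σ (hasDerivAt_neg σ)
    have e : Real.exp (-σ) * -1 = -E := by rw [hEdef]; ring
    rw [e] at h
    exact h
  have hθ : HasDerivAt (fun v => T - Real.exp (-v)) E σ := by
    have h := hexp.const_sub T
    rw [neg_neg] at h
    exact h
  set D : Em m := bigLam ε₀ ^ n • (tableQ α (shellVec X n (T - E))
    + (bigLam ε₀)⁻¹ • tableA α (shellVec X (n - 1) (T - E))
    + tableB α (shellVec X (n + 1) (T - E)) (shellVec X n (T - E))) with hDdef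
  have hS : HasDerivAt (fun v => shellVec X n (T - Real.exp (-v))) (E • D) σ := by
    have h := (hasDerivAt_shellVec_of_exactFlow hε hC1 hmot n ht).scomp σ hθ
    simpa only [Function.comp_def] using h
  have hc : HasDerivAt (fun v => bigLam ε₀ ^ n * Real.exp (-v)) (bigLam ε₀ ^ n * -E) σ :=
    hexp.const_mul _
  have hprod := hc.smul hS
  have hfun : W n = fun v => (bigLam ε₀ ^ n * Real.exp (-v)) • shellVec X n (T - Real.exp (-v)) :=
    funext fun v => hW n v
  have hder : HasDerivAt (W n) ((bigLam ε₀ ^ n * Real.exp (-σ)) • (E • D)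
      + (bigLam ε₀ ^ n * -E) • shellVec X n (T - Real.exp (-σ))) σ := by
    rw [hfun]; exact hprod
  refine hder.congr_deriv ?_
  -- the algebra: everything in terms of the shell vectors at time `t = T - E`
  have hWn : W n σ = (bigLam ε₀ ^ n * E) • shellVec X n (T - E) := by rw [hW]
  have hWm : W (n - 1) σ = (bigLam ε₀ ^ (n - 1) * E) • shellVec X (n - 1) (T - E) := by rw [hW]
  have hWp : W (n + 1) σ = (bigLam ε₀ ^ (n + 1) * E) • shellVec X (n + 1) (T - E) := by rw [hW]
  rw [← hEdef, hWn, hWm, hWp, tableQ_smul, tableA_smul, tableB_smul_smul, hDdef,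
    zpow_sub_one₀ hLne, zpow_add_one₀ hLne]
  simp only [smul_add, smul_smul]
  match_scalars <;> field_simp

/-! ### The dictionary: type I and survival -/

/-- `‖W_n(σ)‖ = Λ^n e^{-σ} ‖x_n(T - e^{-σ})‖` — with `t = T - e^{-σ}` this is the TYPE-I QUANTITY
`Λ^n (T - t)‖X_n(t)‖`. [cite: Tao2016AveragedNS, §6.4; cell vocabulary (`UniformBound`, `TypeIBound`)] -/
theorem renormalisedFlow_norm {ε₀ T : ℝ} (hε : 0 < ε₀) {X : Fin m → ℤ → ℝ → ℝ} {W : ℤ → ℝ → Em m}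
    (hW : ∀ n σ, W n σ = (bigLam ε₀ ^ n * Real.exp (-σ)) • shellVec X n (T - Real.exp (-σ)))
    (n : ℤ) (σ : ℝ) :
    ‖W n σ‖ = bigLam ε₀ ^ n * Real.exp (-σ) * ‖shellVec X n (T - Real.exp (-σ))‖ := by
  have hL : 0 < bigLam ε₀ := bigLam_pos (by linarith)
  rw [hW, norm_smul, Real.norm_eq_abs, abs_of_pos (mul_pos (zpow_pos hL n) (Real.exp_pos _))]

/-- **TYPE I ⟺ UNIFORM BOUND ON THE HALF-LINE.** For the renormalisation `W` of `X` around `T > 0`: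
`W` is bounded by `C` at all `(n, σ)` with `e^{-σ} ≤ T` iff `X` obeys the type-I bound
`Λ^n (T - t)‖X_n(t)‖ ≤ C` for all `n` and all `0 ≤ t < T`.
[cite: Tao2016AveragedNS, §6.4; cell vocabulary (`UniformBound`, the type-I clause of `WakeRatchet.MinimalViscousBlowup`)] -/
theorem uniformBound_iff_typeI {ε₀ T C : ℝ} (hε : 0 < ε₀) {X : Fin m → ℤ → ℝ → ℝ}
    {W : ℤ → ℝ → Em m}
    (hW : ∀ n σ, W n σ = (bigLam ε₀ ^ n * Real.exp (-σ)) • shellVec X n (T - Real.exp (-σ))) :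
    (∀ (n : ℤ) (σ : ℝ), Real.exp (-σ) ≤ T → ‖W n σ‖ ≤ C) ↔
      ∀ (n : ℤ) (t : ℝ), 0 ≤ t → t < T → bigLam ε₀ ^ n * (T - t) * ‖shellVec X n t‖ ≤ C := by
  constructor
  · intro h n t ht0 htT
    have hpos : 0 < T - t := by linarith
    have key := h n (-Real.log (T - t)) (by rw [neg_neg, Real.exp_log hpos]; linarith)
    rwa [renormalisedFlow_norm hε hW, neg_neg, Real.exp_log hpos, sub_sub_cancel] at key
  · intro h n σ hσ
    rw [renormalisedFlow_norm hε hW]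
    have key := h n (T - Real.exp (-σ)) (by linarith) (by linarith [Real.exp_pos (-σ)])
    rwa [sub_sub_cancel] at key

/-- `physWeight 1 ε₀ = ((1+ε₀)^4)⁻¹`. [cite: Tao2016AveragedNS, §4 (4.1); cell vocabulary] -/
theorem physWeight_one_eq {ε₀ : ℝ} (hε : 0 < ε₀) : physWeight 1 ε₀ = (((1 + ε₀) ^ 4)⁻¹ : ℝ) := by
  have hb : (0 : ℝ) < 1 + ε₀ := by linarith
  unfold physWeight
  rw [Real.rpow_one]
  field_simp

/-- **THE `a = 1`-WEIGHTED RENORMALISED ENERGY IS THE PHYSICAL SURVIVAL QUANTITY**: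
`physWeight(1)^n · e^{2σ}‖W_n(σ)‖² = (1+ε₀)^n ‖X_n(t)‖²`, `t = T - e^{-σ}` (shells `n ∈ ℕ`).
[cite: Tao2016AveragedNS, §6.4 and §4 (the viscous equation before Thm. 4.2); cell vocabulary (`EternalSurvivingFwd`)] -/
theorem renormalisedFlow_weightedEnergy {ε₀ T : ℝ} (hε : 0 < ε₀) {X : Fin m → ℤ → ℝ → ℝ}
    {W : ℤ → ℝ → Em m}
    (hW : ∀ n σ, W n σ = (bigLam ε₀ ^ n * Real.exp (-σ)) • shellVec X n (T - Real.exp (-σ)))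
    (n : ℕ) (σ : ℝ) :
    physWeight 1 ε₀ ^ n * (Real.exp (2 * σ) * ‖W n σ‖ ^ 2) =
      (1 + ε₀) ^ n * ‖shellVec X n (T - Real.exp (-σ))‖ ^ 2 := by
  have hb : (0 : ℝ) < 1 + ε₀ := by linarith
  rw [renormalisedFlow_norm hε hW, physWeight_one_eq hε, zpow_natCast, mul_pow, mul_pow,
    bigLam_pow_sq hε.le n, inv_pow, ← pow_mul]
  have hexp : Real.exp (2 * σ) * Real.exp (-σ) ^ 2 = 1 := by
    rw [sq, ← Real.exp_add, ← Real.exp_add, show 2 * σ + (-σ + -σ) = 0 by ring, Real.exp_zero]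
  have h4 : ((1 + ε₀) ^ (4 * n))⁻¹ * (1 + ε₀) ^ (5 * n) = (1 + ε₀) ^ n := by
    rw [show 5 * n = 4 * n + n by ring, pow_add, ← mul_assoc, inv_mul_cancel₀ (pow_ne_zero _ hb.ne'),
      one_mul]
  calc ((1 + ε₀) ^ (4 * n))⁻¹ * (Real.exp (2 * σ) *
        ((1 + ε₀) ^ (5 * n) * Real.exp (-σ) ^ 2 * ‖shellVec X (↑n) (T - Real.exp (-σ))‖ ^ 2))
      = ((1 + ε₀) ^ (4 * n))⁻¹ * (1 + ε₀) ^ (5 * n) * (Real.exp (2 * σ) * Real.exp (-σ) ^ 2) *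
          ‖shellVec X (↑n) (T - Real.exp (-σ))‖ ^ 2 := by ring
    _ = (1 + ε₀) ^ n * ‖shellVec X (↑n) (T - Real.exp (-σ))‖ ^ 2 := by rw [hexp, h4, mul_one]

/-- **PHYSICAL (S₁)-SURVIVAL OF THE BLOW-UP ⇒ FORWARD SURVIVAL OF THE RENORMALISED FLOW.** If for some
`c > 0` and every `N` there are a shell `n ≥ N` and a time `t ∈ [T - e^{-N}, T)` with
`c ≤ (1+ε₀)^n ‖X_n(t)‖²` (the blow-up keeps the survival-weighted shell energy above `c` at arbitrarily
high shells arbitrarily close to `T` — the «lower pinning» of the WakeRatchet cruxes, here without any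
clock), then the renormalisation `W` is forward (S₁)-surviving: `EternalSurvivingFwd 1 ε₀ W`
(witness log-times `σ = -log(T - t) ≥ N`). [cite: Tao2016AveragedNS, §6.4; cell vocabulary (`EternalSurvivingFwd`)] -/
theorem eternalSurvivingFwd_of_physicalSurvival {ε₀ T : ℝ} (hε : 0 < ε₀) {X : Fin m → ℤ → ℝ → ℝ}
    {W : ℤ → ℝ → Em m}
    (hW : ∀ n σ, W n σ = (bigLam ε₀ ^ n * Real.exp (-σ)) • shellVec X n (T - Real.exp (-σ)))
    {c : ℝ} (hc : 0 < c)
    (hsurv : ∀ N : ℕ, ∃ n : ℕ, N ≤ n ∧ ∃ t : ℝ, T - Real.exp (-(N : ℝ)) ≤ t ∧ t < T ∧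
      c ≤ (1 + ε₀) ^ n * ‖shellVec X n t‖ ^ 2) :
    EternalSurvivingFwd 1 ε₀ W := by
  refine ⟨c, hc, fun N => ?_⟩
  obtain ⟨n, hn, t, ht1, ht2, hct⟩ := hsurv N
  have hpos : 0 < T - t := by linarith
  refine ⟨n, hn, -Real.log (T - t), ?_, ?_⟩
  · -- `σ = -log(T-t) ≥ N ⟺ T - t ≤ e^{-N}`
    have h1 : Real.log (T - t) ≤ -(N : ℝ) := by
      rw [← Real.log_exp (-(N : ℝ))]
      exact Real.log_le_log hpos (by linarith)
    linarith
  · rw [renormalisedFlow_weightedEnergy hε hW, neg_neg, Real.exp_log hpos, sub_sub_cancel]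
    exact hct

end BlowupRigidityOne

end Summit.NavierStokesRegularity.NavierStokesRegularity.Theorems

end
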